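/-
Copyright: cell pub-balaban-gaps (YM BLITZ Y1, track G1), seat g1-p2 GEN 5 (unit `pub-balaban-gaps-g1-p2`).  Row (D4) NODE O,
OBJECT ∕ MECHANISM level: the row's first-missing-lemma SHAPE `ExistsUniformAcrossSmall` ((v)⁺) INHABITED by the PARAMETRIX MODEL —
Γ-slot = the σ-decorated glued inverse `S(1 − R)⁻¹` of `D4WalkBlockParametrix` whose seed ∕ step families are BUILT from a
partition of unity, local inverses `G′_□(u)` and commutators `K(h_□)(u)`, equal to `Δ′(u)⁻¹ = (1 + K′(u))⁻¹` at `σ ≡ 1`; the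
package's letters are the PRIMITIVE ones (local-inverse bound `C_L`, commutator bound `λ_K`, partition geometry, one cube row
sum), the Neumann margin is `O(λ_K)` — print's *"K(h_□) = O(M⁻¹), M sufficiently large"* read on the letter that carries it.
HONEST FRAMING: model ∕ mechanism; Bałaban's `Δ^{(k)}`, `G′_□`, `h_□` NOT constructed, (3.42) ∕ Cor 3.6 and (3.88)–(3.89) for
HIS operators NOT proved (letters); (D4) NOT discharged (instance 0∕1); NOT BetaPertH, NOT continuum, NOT Clay.
-/
import Summits.QuantumFields.BalabanUV.Gaps.D4WalkBlockParametrix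
import Summits.QuantumFields.BalabanUV.Gaps.D4WalkModelGlued

/-!
# `Gaps.D4WalkModelParametrix` — (v)⁺ inhabited by the parametrix model: Γ-slot `= Σ_□ h_□G′_□h_□·(1 − Σ_□ K(h_□)G′_□h_□)⁻¹`
from PRIMITIVE letters (cell pub-balaban-gaps, seat g1-p2 gen 5)

HONEST DEPENDENCY (cell pub-balaban, verbatim): continuum YM on T⁴ ⇐ BetaPertH ∧ nine spine estimates (0/9 proved);
BetaPertH ⇐ (D1) ∧ (D4) ∧ CAP+tail.

[B9] (3.87)–(3.90) p. 409, Cor 3.8 p. 410, Thm 3.10 p. 416; [II] (1.11) p. 5, p. 13, p. 15.  The previous (v)⁺ inhabitants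
(`D4WalkModelGlued(Block)`, p359538 ∕ p359993) take the seed ∕ step families as DATA with the (3.89)-shape letters as HYPOTHESES;
HERE the two families are those of (3.87)–(3.88) BUILT from a skeleton carrying local inverses `G′_□(u)`, a partition `{h_□}` and
the commutators `[h_□, K′(u)]` (`D4WalkBlockParametrix`), the hypotheses one rung MORE PRIMITIVE (local-inverse block bound `C_L` =
print's Cor 3.6 ∕ (3.42); commutator block bound `λ_K` inside the domains = print's (3.88), `O(M⁻¹)`; partition data; `#dom □ ≤ n_C`;
geometry; one cube row sum), and (3.88) itself a THEOREM (`resummation_388`).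
* §1 `jointWalkExpansion_submatrix` — reindexing rows ∕ columns along arbitrary maps (the read-off to the `Λ × (Λ ⊕ C₀)` shape).
* §2 `ParametrixModelTerm` (Type-valued datum, nothing asserted), `seedT ∕ stepT ∕ glued`, reality of the reference Γ-kernel
  `S(0,0)(1 − R(0,0))⁻¹` (`glued_zero_eq`), `toKernels` (precision `1`, covariance `1`, Γ-slot the reindexed glued family).
* §3 `termWalkData_parametrix` — `TermWalkData` with the torus-free package `(R, ε₀ − 3μ, κ₀ − 2μ, K̄_glued, 1, 1, R_σ)`,
  `K̄_glued = c_μK̄_S(1·(1 − q)⁻¹)c_μ`, `K̄_S = C_Le^{κ₁m_J}e^{2ρ₀r}e^{μr}n_Dc_μ`, `q = c_μ(c_μ·1·(1·K̄_R)c_μ)c_μ`,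
  `K̄_R = (n_Cλ_KC_L)e^{κ₁m_J}e^{2ρ₀r}e^{μr}n_Dc_μ`, from `blockWalkExpansion_parametrix`.
* §4 `ParametrixModelMember`, **`acrossSmall_parametrix`** — (v)⁺ ACROSS any family of members from COMMON primitive letters:
  the three printed smallness sources each on its own letter — `λ_K` (Neumann margin, *"M sufficiently large"*), `R_σ`
  (σ-smallness, GEOMETRIC), `α∕R` (analyticity).
WHAT IT IS NOT: an instance for Bałaban's `Δ^{(k)}` ∕ `G′_□` ∕ `h_□` (`hLbd`, `hKbd` are letters); precision ∕ covariance
slots FREE; the multi-scale structure, (v) for HIS family, `TermDomination` remain; (D4) instance 0∕1; words UNCHANGED.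
-/

noncomputable section

namespace Summit.QuantumFields.BalabanUV.Gaps.D4WalkModelParametrix

open Metric Set Finset
open Literature.MathematicalPhysics.QuantumFieldTheory.Balaban1983to89
open Literature.MathematicalPhysics.QuantumFieldTheory.Balaban1983to89.B9SectDWalk (Through MajSumLe DomBy)
open Literature.MathematicalPhysics.QuantumFieldTheory.Balaban1983to89.B9Thm34Ext (toB6)
open Literature.MathematicalPhysics.QuantumFieldTheory.Balaban1983to89.B9Thm37GlueTorus (torusGeom tdist1 tdist1_nonneg)
open Literature.MathematicalPhysics.QuantumFieldTheory.Balaban1983to89.TreeLengthTorus (TPt)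
open Literature.MathematicalPhysics.QuantumFieldTheory.Balaban1983to89.B5TorusCover (UT)
open Literature.MathematicalPhysics.QuantumFieldTheory.Balaban1983to89.B11SectG (RowSum)
open Literature.MathematicalPhysics.QuantumFieldTheory.Balaban1983to89.B13JointWalkExpansion (JointWalkExpansion WalkMajorants)
open Literature.MathematicalPhysics.QuantumFieldTheory.Balaban1983to89.B13TermWalkData
  (WalkConsts TermKernels TermWalkData TorusTerms)
open Literature.MathematicalPhysics.QuantumFieldTheory.Balaban1983to89.B13TermWalkDataOneTorus
  (SmallTheta ExistsUniformAcrossSmall acrossSmall_of_decay)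
open Literature.MathematicalPhysics.QuantumFieldTheory.Balaban1983to89.B13DomainKernelWalks (DomainTerms)
open Summit.QuantumFields.BalabanUV.Gaps.D4WalkBlock (blockNorm BlockWalkExpansion)
open Summit.QuantumFields.BalabanUV.Gaps.D4WalkModelAcross (ModelTerm)
open Summit.QuantumFields.BalabanUV.Gaps.D4WalkModelGlued (inv_map_algebraMap)
open Summit.QuantumFields.BalabanUV.Gaps.D4WalkBlockParametrix (blockWalkExpansion_parametrix)
open Summit.QuantumFields.BalabanUV.T4Continuum.Spine.NE5.TwoRunPencilDomains (withOp)
open Summit.QuantumFields.BalabanUV.Beta.UnitLatticeWalkInversion (Hd Pj)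

/-! ## §1. Reindexing a joint walk expansion -/

section Reindex

variable {d N' : ℕ} {ν : ℕ} {Nf : Fin ν → ℕ} [∀ i, NeZero (Nf i)]
variable {p n p' n' : Type}
variable {E : Type*} [NormedAddCommGroup E] [NormedSpace ℂ E]
variable {c : B13.Consts} {locp : p → UT Nf} {locn : n → UT Nf} {K2 : (TPt d N' → ℂ) → E → Matrix p n ℂ}
variable {X : Finset (UT Nf)} {R ε kap Kbar : ℝ}
variable {W : Type} {T2 : W → (TPt d N' → ℂ) → E → Matrix p n ℂ} {SX : Set W} {A : W → ℝ}
variable {D : W → UT Nf → UT Nf → ℝ} {ρ : ℝ}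

/-- **Reindexing rows and columns** of a joint walk expansion along arbitrary maps `f`, `g` (locators composed): every field is
entrywise or index-free. [cite: Balaban1985BackgroundPropagators, (3.107)–(3.108) p.416] -/
theorem jointWalkExpansion_submatrix (h : JointWalkExpansion c locp locn K2 X R ε kap Kbar T2 SX A D ρ) (f : p' → p)
    (g : n' → n) :
    JointWalkExpansion c (locp ∘ f) (locn ∘ g) (fun σ u => (K2 σ u).submatrix f g) X R ε kap Kbar
      (fun ω σ u => (T2 ω σ u).submatrix f g) SX A D ρ where
  hasSum σ hσ u hu i j := h.hasSum σ hσ u hu (f i) (g j)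
  termAnalytic ω σ hσ i j := h.termAnalytic ω σ hσ (f i) (g j)
  maj ω σ hσ u hu i j := h.maj ω σ hσ u hu (f i) (g j)
  majSum := h.majSum
  indep ω hω σ hσ := congrArg (fun M : Matrix p n ℂ => M.submatrix f g) (h.indep ω hω σ hσ)
  through := h.through
  A_nonneg := h.A_nonneg
  D_nonneg := h.D_nonneg

end Reindex

/-! ## §2. The parametrix model term -/

section Model

variable {d N' : ℕ} {ν : ℕ} {K : Fin ν → ℕ} [∀ i, NeZero (K i)]
variable {E : Type*} [NormedAddCommGroup E] [NormedSpace ℂ E]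

/-- PARAMETRIX MODEL TERM DATUM (Type-valued, nothing asserted): sites `n` with cube map, σ-region `X`, a skeleton `L` whose
coefficient `L.op □ u` is the local inverse `G′_□(u)`, a real partition `h` with supports `Es`, `K′` (`Δ′(u) = 1 + K′(u)`), reality
of `G′_□(0)`, `K′(0)` (print p. 15), the Γ-slot's row ∕ column index maps into the sites, the rows' fibre bound. -/
structure ParametrixModelTerm (d N' ν : ℕ) (K : Fin ν → ℕ) [∀ i, NeZero (K i)]
    (E : Type*) [NormedAddCommGroup E] [NormedSpace ℂ E] where
  n : Type
  [instFintype : Fintype n]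
  [instDecEq : DecidableEq n]
  cubn : n → UT K
  X : Finset (UT K)
  L : DomainTerms d N' ν K n n E
  h : L.B → n → ℝ
  Es : L.B → Finset n
  K' : E → Matrix n n ℂ
  hrealL : ∀ b i j, (L.op b 0 i j).im = 0
  hrealK : ∀ i j, (K' 0 i j).im = 0
  Λ : Type
  [instFintypeΛ : Fintype Λ]
  [instDecEqΛ : DecidableEq Λ]
  C₀ : Type
  rowOf : Λ → n
  colOf : Λ ⊕ C₀ → n
  m : ℕ
  hfib : ∀ x : UT K, (Finset.univ.filter fun i => cubn (rowOf i) = x).card ≤ m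

/-- The site type of a parametrix model term is finite (bundled instance, exposed). -/
instance ParametrixModelTerm.instFintypeN (t : ParametrixModelTerm d N' ν K E) : Fintype t.n := t.instFintype
/-- The site type of a parametrix model term has decidable equality (bundled instance, exposed). -/
instance ParametrixModelTerm.instDecEqN (t : ParametrixModelTerm d N' ν K E) : DecidableEq t.n := t.instDecEq
/-- The row type of a parametrix model term is finite (bundled instance, exposed). -/
instance ParametrixModelTerm.instFintypeRow (t : ParametrixModelTerm d N' ν K E) : Fintype t.Λ := t.instFintypeΛ
/-- The row type of a parametrix model term has decidable equality (bundled instance, exposed). -/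
instance ParametrixModelTerm.instDecEqRow (t : ParametrixModelTerm d N' ν K E) : DecidableEq t.Λ := t.instDecEqΛ

namespace ParametrixModelTerm

variable (c : B13.Consts) (t : ParametrixModelTerm d N' ν K E)

/-- The SEED family `□ ↦ h_□G′_□(u)h_□` on the skeleton ([B9] (3.87)). -/
def seedT : DomainTerms d N' ν K t.n t.n E := withOp t.L fun b u => Hd t.h b * t.L.op b u * Hd t.h b

/-- The STEP family `□ ↦ K(h_□)(u)G′_□(u)h_□`, `K(h_□) = h_□K′ − K′h_□` ([B9] (3.88)). -/
def stepT : DomainTerms d N' ν K t.n t.n E :=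
  withOp t.L fun b u => (Hd t.h b * t.K' u - t.K' u * Hd t.h b) * t.L.op b u * Hd t.h b

/-- The σ-decorated GLUED family `S(σ,u)·(1 − R(σ,u))⁻¹` ((3.90); `= (1 + K′(u))⁻¹` at `σ ≡ 1`, `glued_one_eq_inv`). -/
def glued : (TPt d N' → ℂ) → E → Matrix t.n t.n ℂ :=
  fun σ u => t.seedT.kernel σ u * ((1 : Matrix t.n t.n ℂ) + (-1 : ℂ) • t.stepT.kernel σ u)⁻¹

/-! ### Reality at the reference point `(σ,u) = (0,0)` -/

/-- The s-monomial at `σ = 0` is real (it is `1` on an empty parameter set and `0` otherwise). -/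
private theorem im_prod_zero (J : Finset (TPt d N')) : (∏ _j ∈ J, (0 : ℂ)).im = 0 := by
  rw [Finset.prod_const]
  rcases Nat.eq_zero_or_pos J.card with h0 | hpos
  · rw [h0, pow_zero, Complex.one_im]
  · rw [zero_pow (Nat.pos_iff_ne_zero.1 hpos), Complex.zero_im]

/-- Products of matrices with real entries have real entries. -/
private theorem im_mul_apply {A B : Matrix t.n t.n ℂ} (hA : ∀ i j, (A i j).im = 0) (hB : ∀ i j, (B i j).im = 0)
    (i j : t.n) : ((A * B) i j).im = 0 := by
  rw [Matrix.mul_apply, Complex.im_sum]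
  exact Finset.sum_eq_zero fun k _ => by rw [Complex.mul_im, hA i k, hB k j, mul_zero, zero_mul, add_zero]

/-- The partition matrix has real entries. -/
private theorem im_Hd (b : t.L.B) (i j : t.n) : (Hd t.h b i j).im = 0 := by
  unfold Hd
  by_cases hij : i = j
  · subst hij; rw [Matrix.diagonal_apply_eq, Complex.ofReal_im]
  · rw [Matrix.diagonal_apply_ne _ hij, Complex.zero_im]

/-- A domain datum whose coefficients are real at `u = 0` has a real kernel at `(σ,u) = (0,0)`. -/
private theorem im_kernel_zero (L' : DomainTerms d N' ν K t.n t.n E) (hreal : ∀ b i j, (L'.op b 0 i j).im = 0) (i j : t.n) :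
    (L'.kernel 0 0 i j).im = 0 := by
  rw [DomainTerms.kernel_apply, Complex.im_sum]
  refine Finset.sum_eq_zero fun b _ => ?_
  rw [DomainTerms.term_apply, Complex.mul_im, hreal b i j, mul_zero, zero_add]
  have h0 : (∏ j ∈ L'.J b, (0 : TPt d N' → ℂ) j).im = 0 := im_prod_zero (L'.J b)
  rw [h0, zero_mul]

/-- The seed kernel is real at the reference point. -/
theorem im_seed_zero (i j : t.n) : (t.seedT.kernel 0 0 i j).im = 0 :=
  im_kernel_zero t t.seedT (fun b i j => by
    change ((Hd t.h b * t.L.op b 0 * Hd t.h b) i j).im = 0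
    exact im_mul_apply t (im_mul_apply t (im_Hd t b) (t.hrealL b)) (im_Hd t b) i j) i j

/-- The step kernel is real at the reference point. -/
theorem im_step_zero (i j : t.n) : (t.stepT.kernel 0 0 i j).im = 0 :=
  im_kernel_zero t t.stepT (fun b i j => by
    change (((Hd t.h b * t.K' 0 - t.K' 0 * Hd t.h b) * t.L.op b 0 * Hd t.h b) i j).im = 0
    have hcomm : ∀ i j, ((Hd t.h b * t.K' 0 - t.K' 0 * Hd t.h b) i j).im = 0 := fun i j => by
      rw [Matrix.sub_apply, Complex.sub_im, im_mul_apply t (im_Hd t b) t.hrealK i j, im_mul_apply t t.hrealK (im_Hd t b) i j, sub_zero]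
    exact im_mul_apply t (im_mul_apply t hcomm (t.hrealL b)) (im_Hd t b) i j) i j

/-- The real reference seed `Re S(0,0)`. -/
def refS : Matrix t.n t.n ℝ := (t.seedT.kernel 0 0).map Complex.re

/-- The real reference step `Re R(0,0)`. -/
def refR : Matrix t.n t.n ℝ := (t.stepT.kernel 0 0).map Complex.re

/-- `S(0,0)` is the complexification of its real part. -/
theorem seed_zero_eq : t.seedT.kernel 0 0 = t.refS.map (algebraMap ℝ ℂ) := by
  ext i j; simp only [refS, Matrix.map_apply]; apply Complex.ext <;> simp [t.im_seed_zero i j]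

/-- `1 − R(0,0)` is the complexification of `1 − Re R(0,0)`. -/
theorem one_sub_step_zero_eq :
    (1 : Matrix t.n t.n ℂ) + (-1 : ℂ) • t.stepT.kernel 0 0 = ((1 : Matrix t.n t.n ℝ) - t.refR).map (algebraMap ℝ ℂ) := by
  ext i j
  simp only [Matrix.add_apply, Matrix.smul_apply, Matrix.map_apply, Matrix.sub_apply, Matrix.one_apply, smul_eq_mul, map_sub,
    refR]
  have hre : t.stepT.kernel 0 0 i j = ((t.stepT.kernel 0 0 i j).re : ℂ) := by
    apply Complex.ext <;> simp [t.im_step_zero i j]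
  split_ifs <;> (rw [hre]; simp [sub_eq_add_neg])

/-- **THE REFERENCE Γ-KERNEL IS REAL**: `S(0,0)(1 − R(0,0))⁻¹ = (Re S(0,0)·(1 − Re R(0,0))⁻¹).map ofReal` (print p. 15: at the
real reference configuration the operators are real). [cite: Balaban1988RG2Cluster, p.15] -/
theorem glued_zero_eq : t.glued 0 0 = (t.refS * ((1 : Matrix t.n t.n ℝ) - t.refR)⁻¹).map (algebraMap ℝ ℂ) := by
  unfold glued
  rw [one_sub_step_zero_eq, inv_map_algebraMap, seed_zero_eq, ← Matrix.map_mul]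

/-- The parametrix model `TermKernels` record: precision `1`, covariance `1 ≻ 0`, Γ-slot the glued family reindexed to
`Λ × (Λ ⊕ C₀)`, `Γ₀` its real reference value; locators the cube map along the index maps. -/
def toKernels : TermKernels c d N' ν K E where
  Λ := t.Λ
  C₀ := t.C₀
  A2 := fun _ _ => 1
  G2 := fun σ u => (t.glued σ u).submatrix t.rowOf t.colOf
  Γ₀ := (t.refS * ((1 : Matrix t.n t.n ℝ) - t.refR)⁻¹).submatrix t.rowOf t.colOf
  C := 1
  locΛ := t.cubn ∘ t.rowOf
  locN := t.cubn ∘ t.colOf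
  X := t.X
  m := t.m
  hfib := t.hfib
  hG0 := by rw [glued_zero_eq, Matrix.submatrix_map]
  hC0 := by rw [inv_one, Matrix.map_one _ (map_zero _) (map_one _)]
  hC := Matrix.PosDef.one

/-! ## §3. `TermWalkData` for the parametrix model term from PRIMITIVE letters -/

variable {c t}

/-- **`TermWalkData` FOR THE PARAMETRIX MODEL TERM, PRIMITIVE LETTERS.**  Skeleton geometry (anchors, diameter `r`, `|J| ≤ m_J`,
σ-terms meet `X`, multiplicity `n_D`, `#dom ≤ n_C`); partition (`|h| ≤ 1`, supports with cubes inside the domains); local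
inverses holomorphic with block bound `C_L` on the `R`-ball; `K′` holomorphic, commutators `[h_□, K′(u)]` with block bound `λ_K`
and blocks inside the domains; one cube row-sum rate `μ` (`c_μ`); rates `0 ≤ μ`, `3μ ≤ ε₀`, `2μ ≤ κ₀`, `κ₀ + μ ≤ ρ₀ − ε₀`;
margin `q = c_μ(c_μ·1·(1·K̄_R)c_μ)c_μ < 1`, `K̄_R = (n_Cλ_KC_L)e^{κ₁m_J}e^{2ρ₀r}e^{μr}n_Dc_μ`; rows `R_σ`-far from `X`.  Package
`(R, ε₀ − 3μ, κ₀ − 2μ, K̄_glued, 1, 1, R_σ)` — no letter depends on the torus.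
[cite: Balaban1985BackgroundPropagators, (3.87)–(3.90) p.409, Cor 3.8 p.410, Thm 3.10 p.416; Balaban1988RG2Cluster, (1.11) p.5, p.13, p.15] -/
theorem termWalkData_parametrix {R CL lamK r : ℝ} {mJ nD nC : ℕ} {ρ₀ ε₀ κ₀ μ cμ Rσ : ℝ}
    (hanchor : ∀ b, t.L.anchor b ∈ t.L.dom b) (hdiam : ∀ b, ∀ z ∈ t.L.dom b, ∀ z' ∈ t.L.dom b, tdist1 K z z' ≤ r)
    (hJ : ∀ b, (t.L.J b).card ≤ mJ) (hX : ∀ b, (t.L.J b).Nonempty → (t.L.dom b ∩ t.X).Nonempty)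
    (hmult : ∀ z : UT K, (Finset.univ.filter fun b => t.L.anchor b = z).card ≤ nD)
    (hsupp : ∀ b y, y ∉ t.Es b → t.h b y = 0) (habs : ∀ b y, |t.h b y| ≤ 1) (hE : ∀ b y, y ∈ t.Es b → t.cubn y ∈ t.L.dom b)
    (hLan : ∀ b i j, DifferentiableOn ℂ (fun u => t.L.op b u i j) (ball (0 : E) R))
    (hLbd : ∀ b, ∀ u ∈ ball (0 : E) R, ∀ y y', blockNorm t.cubn t.cubn (t.L.op b u) y y' ≤ CL) (hCL : 0 ≤ CL)
    (hKan : ∀ i j, DifferentiableOn ℂ (fun u => t.K' u i j) (ball (0 : E) R))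
    (hKbd : ∀ b, ∀ u ∈ ball (0 : E) R, ∀ y y', blockNorm t.cubn t.cubn (Hd t.h b * t.K' u - t.K' u * Hd t.h b) y y' ≤ lamK)
    (hlamK : 0 ≤ lamK)
    (hKsupp : ∀ b u y y', blockNorm t.cubn t.cubn (Hd t.h b * t.K' u - t.K' u * Hd t.h b) y y' ≠ 0 →
      y ∈ t.L.dom b ∧ y' ∈ t.L.dom b)
    (hcard : ∀ b, (t.L.dom b).card ≤ nC)
    (hκ₁ : 0 ≤ c.κ₁) (hμ : 0 ≤ μ) (hμε : 3 * μ ≤ ε₀) (hμκ : 2 * μ ≤ κ₀) (hwin : κ₀ + μ ≤ ρ₀ - ε₀) (hcμ : 0 ≤ cμ)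
    (hrow : RowSum (toB6 (torusGeom K 0 0 0) 0 True) μ cμ)
    (hq : cμ * (cμ * 1 *
      (1 * (((nC * lamK * CL) * Real.exp (c.κ₁ * mJ) * Real.exp (2 * ρ₀ * r)) * Real.exp (μ * r) * (nD * cμ))) * cμ) *
        cμ < 1)
    (hfar : ∀ b : t.Λ, ∀ z ∈ t.X, Rσ ≤ tdist1 K (t.cubn (t.rowOf b)) z) :
    TermWalkData (t.toKernels c)
      ⟨R, ε₀ - 3 * μ, κ₀ - 2 * μ,
        cμ * ((CL * Real.exp (c.κ₁ * mJ) * Real.exp (2 * ρ₀ * r)) * Real.exp (μ * r) * (nD * cμ)) *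
          (1 * (1 - cμ * (cμ * 1 *
            (1 * (((nC * lamK * CL) * Real.exp (c.κ₁ * mJ) * Real.exp (2 * ρ₀ * r)) * Real.exp (μ * r) * (nD * cμ))) *
              cμ) * cμ)⁻¹) * cμ,
        1, 1, Rσ⟩ := by
  obtain ⟨W, T, SX, A, D, ρ', hB, -⟩ := blockWalkExpansion_parametrix (L := t.L) (h := t.h) (Es := t.Es) (K' := t.K')
    (c := c) (cubn := t.cubn) (X := t.X) hanchor hdiam hJ hX hmult hsupp habs hE hLan hLbd hCL hKan hKbd hlamK hKsupp hcard
    hκ₁ hμ hμε hμκ hwin hcμ hrow hq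
  refine ⟨⟨W, fun ω σ u => (T ω σ u).submatrix t.rowOf t.colOf, SX, A, D, ρ', ?_⟩, ?_, ?_, hfar⟩
  · exact jointWalkExpansion_submatrix hB.toJoint t.rowOf t.colOf
  · exact ⟨Unit, fun _ _ _ => 1, ∅, fun _ => 1, fun _ => tdist1 K, (κ₀ - 2 * μ) + (ε₀ - 3 * μ),
      ModelTerm.jointWalkExpansion_one (d := d) (N' := N') (E := E) c (t.cubn ∘ t.rowOf) t.X R (ε₀ - 3 * μ) (κ₀ - 2 * μ)⟩
  · exact ⟨Unit, fun _ _ _ => (1 : Matrix t.Λ t.Λ ℂ)⁻¹, fun _ => 1, fun _ => tdist1 K, κ₀ - 2 * μ,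
      ModelTerm.walkMajorants_one_inv (d := d) (N' := N') (E := E) c (t.cubn ∘ t.rowOf) R (κ₀ - 2 * μ)⟩

end ParametrixModelTerm

end Model

/-! ## §4. (v)⁺ across a family of parametrix model members — all three smallness sources on primitive letters -/

section Across

variable {d : ℕ}

/-- PARAMETRIX MODEL MEMBER: own cube torus, configuration space, term index, one parametrix model term per term. -/
structure ParametrixModelMember (d : ℕ) where
  N' : ℕ
  ν : ℕ
  K : Fin ν → ℕ
  [instK : ∀ i, NeZero (K i)]
  E : Type
  [instE₁ : NormedAddCommGroup E]
  [instE₂ : NormedSpace ℂ E]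
  ι : Type
  t : ι → ParametrixModelTerm d N' ν K E

/-- The member's torus side lengths are non-zero (bundled instance, exposed). -/
instance ParametrixModelMember.instNeZeroK (M : ParametrixModelMember d) (i : Fin M.ν) : NeZero (M.K i) := M.instK i

/-- The member's configuration space is a normed group (bundled instance, exposed). -/
instance ParametrixModelMember.instNormedAddCommGroupE (M : ParametrixModelMember d) : NormedAddCommGroup M.E := M.instE₁

/-- The member's configuration space is a complex normed space (bundled instance, exposed). -/
instance ParametrixModelMember.instNormedSpaceE (M : ParametrixModelMember d) : NormedSpace ℂ M.E := M.instE₂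

/-- The member as a `TorusTerms` record. -/
def ParametrixModelMember.toTorusTerms (c : B13.Consts) (M : ParametrixModelMember d) : TorusTerms c d where
  N' := M.N'
  ν := M.ν
  Nf := M.K
  E := M.E
  ι := M.ι
  𝒦 := fun i => (M.t i).toKernels c

variable {c : B13.Consts}

/-- **(v)⁺ ACROSS A FAMILY OF PARAMETRIX MODEL MEMBERS FROM COMMON PRIMITIVE LETTERS.**  For every member and term: the skeleton
geometry `(r, m_J, n_D, n_C)`, partition data, local inverses holomorphic with block bound `C_L`, `K′` holomorphic with commutator
block bound `λ_K` inside the domains, one cube row-sum rate `μ` (`c_μ`) on every member's cube torus, rows `Rσ₀`-far from `X`;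
rates with `2μ < κ₀`; margin `q < 1` (a condition on `λ_K` ALONE at fixed geometry); numerics `0 ≤ α < R`,
`2·max(K̄_glued, 1)·(e^{−(ε₀−3μ)Rσ₀} + α∕R) ≤ θ₀` ⟹ `ExistsUniformAcrossSmall`.  Print's three smallness sources, each on its own
primitive letter: `λ_K` (*"K(h_□) = O(M⁻¹), M sufficiently large"*), `Rσ₀` (*"dist(X, Z₀) > ⅔M"*), `α∕R` (the bigger analyticity
space). [cite: Balaban1988RG2Cluster, (1.11) p.5, p.13, p.15, (2.16) p.16; Balaban1985BackgroundPropagators, Thm 3.7 p.409, Cor 3.8 p.410, Thm 3.10 p.416] -/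
theorem acrossSmall_parametrix {S : Type*} (𝓜 : S → ParametrixModelMember d) {R CL lamK r : ℝ} {mJ nD nC : ℕ}
    {ρ₀ ε₀ κ₀ μ cμ Rσ₀ α θ₀ : ℝ}
    (hanchor : ∀ s (i : (𝓜 s).ι) b, ((𝓜 s).t i).L.anchor b ∈ ((𝓜 s).t i).L.dom b)
    (hdiam : ∀ s (i : (𝓜 s).ι) b, ∀ z ∈ ((𝓜 s).t i).L.dom b, ∀ z' ∈ ((𝓜 s).t i).L.dom b, tdist1 (𝓜 s).K z z' ≤ r)
    (hJ : ∀ s (i : (𝓜 s).ι) b, (((𝓜 s).t i).L.J b).card ≤ mJ)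
    (hX : ∀ s (i : (𝓜 s).ι) b, (((𝓜 s).t i).L.J b).Nonempty → (((𝓜 s).t i).L.dom b ∩ ((𝓜 s).t i).X).Nonempty)
    (hmult : ∀ s (i : (𝓜 s).ι) (z : UT (𝓜 s).K), (Finset.univ.filter fun b => ((𝓜 s).t i).L.anchor b = z).card ≤ nD)
    (hsupp : ∀ s (i : (𝓜 s).ι) b y, y ∉ ((𝓜 s).t i).Es b → ((𝓜 s).t i).h b y = 0)
    (habs : ∀ s (i : (𝓜 s).ι) b y, |((𝓜 s).t i).h b y| ≤ 1)
    (hE : ∀ s (i : (𝓜 s).ι) b y, y ∈ ((𝓜 s).t i).Es b → ((𝓜 s).t i).cubn y ∈ ((𝓜 s).t i).L.dom b)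
    (hLan : ∀ s (i : (𝓜 s).ι) b k l, DifferentiableOn ℂ (fun u => ((𝓜 s).t i).L.op b u k l) (ball (0 : (𝓜 s).E) R))
    (hLbd : ∀ s (i : (𝓜 s).ι) b, ∀ u ∈ ball (0 : (𝓜 s).E) R, ∀ y y',
      blockNorm ((𝓜 s).t i).cubn ((𝓜 s).t i).cubn (((𝓜 s).t i).L.op b u) y y' ≤ CL)
    (hKan : ∀ s (i : (𝓜 s).ι) k l, DifferentiableOn ℂ (fun u => ((𝓜 s).t i).K' u k l) (ball (0 : (𝓜 s).E) R))
    (hKbd : ∀ s (i : (𝓜 s).ι) b, ∀ u ∈ ball (0 : (𝓜 s).E) R, ∀ y y',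
      blockNorm ((𝓜 s).t i).cubn ((𝓜 s).t i).cubn
        (Hd ((𝓜 s).t i).h b * ((𝓜 s).t i).K' u - ((𝓜 s).t i).K' u * Hd ((𝓜 s).t i).h b) y y' ≤ lamK)
    (hKsupp : ∀ s (i : (𝓜 s).ι) b u y y',
      blockNorm ((𝓜 s).t i).cubn ((𝓜 s).t i).cubn
        (Hd ((𝓜 s).t i).h b * ((𝓜 s).t i).K' u - ((𝓜 s).t i).K' u * Hd ((𝓜 s).t i).h b) y y' ≠ 0 →
      y ∈ ((𝓜 s).t i).L.dom b ∧ y' ∈ ((𝓜 s).t i).L.dom b)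
    (hcard : ∀ s (i : (𝓜 s).ι) b, (((𝓜 s).t i).L.dom b).card ≤ nC)
    (hrow : ∀ s, RowSum (toB6 (torusGeom (𝓜 s).K 0 0 0) 0 True) μ cμ)
    (hfar : ∀ s (i : (𝓜 s).ι) (b : ((𝓜 s).t i).Λ), ∀ z ∈ ((𝓜 s).t i).X,
      Rσ₀ ≤ tdist1 (𝓜 s).K (((𝓜 s).t i).cubn (((𝓜 s).t i).rowOf b)) z)
    (hκ₁ : 0 ≤ c.κ₁) (hCL : 0 ≤ CL) (hlamK : 0 ≤ lamK) (hμ : 0 ≤ μ) (hμε : 3 * μ ≤ ε₀) (hμκ : 2 * μ < κ₀)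
    (hwin : κ₀ + μ ≤ ρ₀ - ε₀) (hcμ : 0 ≤ cμ)
    (hq : cμ * (cμ * 1 *
      (1 * (((nC * lamK * CL) * Real.exp (c.κ₁ * mJ) * Real.exp (2 * ρ₀ * r)) * Real.exp (μ * r) * (nD * cμ))) * cμ) *
        cμ < 1)
    (hα : 0 ≤ α) (hαR : α < R)
    (hθ : 2 * max (cμ * ((CL * Real.exp (c.κ₁ * mJ) * Real.exp (2 * ρ₀ * r)) * Real.exp (μ * r) * (nD * cμ)) *
          (1 * (1 - cμ * (cμ * 1 *
            (1 * (((nC * lamK * CL) * Real.exp (c.κ₁ * mJ) * Real.exp (2 * ρ₀ * r)) * Real.exp (μ * r) * (nD * cμ))) *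
              cμ) * cμ)⁻¹) * cμ) 1
        * (Real.exp (-((ε₀ - 3 * μ) * Rσ₀)) + α / R) ≤ θ₀) :
    ExistsUniformAcrossSmall (fun s => (𝓜 s).toTorusTerms c) α Rσ₀ θ₀ := by
  have hq1 : 0 < 1 - cμ * (cμ * 1 *
      (1 * (((nC * lamK * CL) * Real.exp (c.κ₁ * mJ) * Real.exp (2 * ρ₀ * r)) * Real.exp (μ * r) * (nD * cμ))) * cμ) *
        cμ := by linarith
  have hK : 0 ≤ cμ * ((CL * Real.exp (c.κ₁ * mJ) * Real.exp (2 * ρ₀ * r)) * Real.exp (μ * r) * (nD * cμ)) *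
      (1 * (1 - cμ * (cμ * 1 *
        (1 * (((nC * lamK * CL) * Real.exp (c.κ₁ * mJ) * Real.exp (2 * ρ₀ * r)) * Real.exp (μ * r) * (nD * cμ))) *
          cμ) * cμ)⁻¹) * cμ := by
    positivity
  exact acrossSmall_of_decay
    ⟨R, ε₀ - 3 * μ, κ₀ - 2 * μ,
      cμ * ((CL * Real.exp (c.κ₁ * mJ) * Real.exp (2 * ρ₀ * r)) * Real.exp (μ * r) * (nD * cμ)) *
        (1 * (1 - cμ * (cμ * 1 *
          (1 * (((nC * lamK * CL) * Real.exp (c.κ₁ * mJ) * Real.exp (2 * ρ₀ * r)) * Real.exp (μ * r) * (nD * cμ))) *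
            cμ) * cμ)⁻¹) * cμ,
      1, 1, Rσ₀⟩
    ⟨hαR, by linarith, by linarith, hK, zero_le_one, zero_le_one, le_rfl⟩
    (fun s i => ParametrixModelTerm.termWalkData_parametrix (hanchor s i) (hdiam s i) (hJ s i) (hX s i) (hmult s i)
      (hsupp s i) (habs s i) (hE s i) (hLan s i) (hLbd s i) hCL (hKan s i) (hKbd s i) hlamK (hKsupp s i) (hcard s i)
      hκ₁ hμ hμε hμκ.le hwin hcμ (hrow s) hq (hfar s i))
    (le_max_left _ _) (le_max_right _ _) hα hθ

end Across

end Summit.QuantumFields.BalabanUV.Gaps.D4WalkModelParametrix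

end
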